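import Summits.BirchSwinnertonDyer.Rank1Residual.P2.WindowsAtTwo
import Literature.NumberTheory.EllipticCurves.Tian2014.CongruentNumbersHeegnerPoints
import HarnessLib

/-!
# Sub-lane «bsd-p2»: the P2 consumer of Tian 2014 (Camb. J. Math. 2) Thm 1.3 — the congruent
# number curves `E^{(m)}`, `m = p₀p₁⋯p_k` or `2p₀⋯p_k` with (1.1): `BSD(E^{(m)}, 2)` is EQUIVALENT to
# `ord₂ #Ш_an(E^{(m)}) = 0` (the ALGEBRAIC `2`-part is settled in print), inside the open O12 corner

HONEST FRAMING (sub-lane «bsd-p2», run/shared/lean/b2b/bsd-rank1-residual/p2/, verbatim in every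
file): the target of record is the FULL Birch–Swinnerton-Dyer formula for EVERY analytic-rank `≤ 1`
`E/ℚ` at ALL primes INCLUDING `2`; the odd-prime class ledger is referee A's; the `2`-part is OPEN
(cells O1 = X5 ∖ CM and O12 = the CM corner) and under census by «bsd-p2». Census / instrument
output at `2` = EVIDENCE / conjecture items with held-out validation, NEVER a Literature fact;
certificates close PAIRS (one isogeny class, `p = 2`), never classes. This file asserts NO
arithmetic fact: its input is the AS-PRINTED named fact `Tian2014.thm13_rank_one_and_sha_odd`
(p2-lit-1, p310088; nothing asserted) taken as an explicit binder; NO GZK, NO modularity binder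
(the printed theorem states `rank = 1 = ord_{s=1}` and the finiteness and ODD ORDER of `Ш`). It is
the mirror image of `P2/CountsAtTwo.lean`: there print settles the ANALYTIC side and the pair
closes on the algebraic count; here print settles the ALGEBRAIC `2`-part (`Ш(E^{(m)})[2^∞] = 0`,
Remark 1.4 of the source: the `2`-part of the formula is NOT claimed) and the pair closes on the
exact `2`-adic valuation of `#Ш_an(E^{(m)}) = L′(E^{(m)},1)·#tor²/(Ω·∏c_ℓ·R)` ALONE — the
"Gross–Zagier heights at `2`" item of mandate (i). A per-pair statement; it closes no class and
recolours no cell. Nothing booked; no mark moved. Unit `b2b-bsdres-p2-typer` GEN 2 (gen-1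
TYPING-PLAN §4 (c): "doors for Tian 2014 … APPENDED when p2-lit-1/2's decls land"; NEW file —
`WindowsAtTwo.lean` untouched, append-only rule).

## Contents

* §1 Bookkeeping: Tian's `m` is square-free (`n = p₀⋯p_k` distinct odd primes; `2n`), so the tree's
  model `congruentNumberCurve m : y² = x³ − m²x` is elliptic and globally minimal
  (`isGloballyMinimal_congruentNumberCurve`).
* §2 PAIR FORM `bsdp_two_iff_shaAn_twoAdicUnit_of_tian13`: in Tian's setting (binders verbatim as
  typed: `p : Fin (k+1) → ℕ` injective odd primes, `pᵢ ≡ 1 (8)` for `i ≠ 0`, `n = ∏ pᵢ`,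
  `K ⊇ √−2n` quadratic with (1.1) `Condition11 n K`, `m ∈ {n, 2n}`, `m ≡ 5, 6, 7 (8)`):
  `r_an(E^{(m)}) = 1` and `BSDp (congruentNumberCurve m) 2 ⟺ ∃ q ∈ ℚ, #Ш_an = q ∧ ord₂ q = 0`.
* §3 GRID: `E^{(m)}` has CM by `ℤ[i]` (`j = 1728`), `2` RAMIFIED in `ℚ(i)`, analytic rank `1`: cell
  `r1.*.*.ramified`, status `openO12` (`status_congruentNumberCurve_of_tian13`) — a sub-family of the
  open CM corner whose algebraic `2`-part is in print; the Li–Liu–Tian family of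
  `P2/WindowsAtTwo.lean` (`n ≡ 5 (8)`, all `q ≡ 1 (4)`, no class of order `4`) is the sub-family
  where print closes BOTH sides.

References: Y. Tian, Camb. J. Math. 2 (2014) 117–161, Thm 1.3 and Rem 1.4 [Tian2014]; Miller 2011
Def 1.1 [Miller2011LMS]; HOME/p2/LIT-STATUS.md §T1 (Tian 2014 rows); HOME/p2/typer/TYPING-PLAN.md
§4 (c).
-/

noncomputable section

open scoped Classical

open WeierstrassCurve Literature.NumberTheory.EllipticCurves
  Literature.NumberTheory.EllipticCurves.Rank1Residual
  Literature.NumberTheory.EllipticCurves.Rank1Residual.Typed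
  Literature.NumberTheory.EllipticCurves.Tian2014

set_option autoImplicit false

namespace Summit.BirchSwinnertonDyer.Rank1Residual.P2

/-! ## §1 Tian's `m` is square-free -/

/-- A product of distinct primes is square-free. [folklore] -/
theorem squarefree_prod_of_injective_prime {k : ℕ} (p : Fin (k + 1) → ℕ) (hp : ∀ i, (p i).Prime)
    (hinj : Function.Injective p) : Squarefree (∏ i, p i) := by
  rw [Nat.squarefree_iff_prime_squarefree]
  intro q hqn hqq
  have hq : Prime q := hqn.prime
  -- `q = p j` for some `j`
  obtain ⟨j, -, hj⟩ := hq.exists_mem_finset_dvd (dvd_trans (Dvd.intro q rfl) hqq)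
  have hqj : q = p j := (Nat.prime_dvd_prime_iff_eq hqn (hp j)).mp hj
  -- cancel one factor `q = p j`
  rw [← Finset.mul_prod_erase Finset.univ p (Finset.mem_univ j), ← hqj] at hqq
  have hq' : q ∣ ∏ i ∈ Finset.univ.erase j, p i := Nat.dvd_of_mul_dvd_mul_left hqn.pos hqq
  obtain ⟨l, hl, hl'⟩ := hq.exists_mem_finset_dvd hq'
  have hql : q = p l := (Nat.prime_dvd_prime_iff_eq hqn (hp l)).mp hl'
  have hlj : l = j := hinj (hql.symm.trans hqj)
  exact (Finset.ne_of_mem_erase hl) hlj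

/-- A product of primes `≠ 2` is odd. [folklore] -/
theorem odd_prod_of_prime_ne_two {k : ℕ} (p : Fin (k + 1) → ℕ) (hp : ∀ i, (p i).Prime)
    (hp2 : ∀ i, p i ≠ 2) : Odd (∏ i, p i) := by
  exact Finset.prod_induction p (fun x => Odd x) (fun a b ha hb => ha.mul hb) odd_one
    (fun i _ => (hp i).odd_of_ne_two (hp2 i))

/-- **Tian's `m ∈ {n, 2n}` is square-free** (`n` a product of distinct odd primes).
[cite: Tian2014, Thm. 1.3 setting (arXiv:1210.8231 p. 2, L5–L8)] -/
theorem squarefree_of_tian13_setting {k : ℕ} (p : Fin (k + 1) → ℕ) (hp : ∀ i, (p i).Prime)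
    (hp2 : ∀ i, p i ≠ 2) (hinj : Function.Injective p) {n : ℕ} (hn : n = ∏ i, p i) {m : ℕ}
    (hm : m = n ∨ m = 2 * n) : Squarefree m := by
  have hsq : Squarefree n := hn ▸ squarefree_prod_of_injective_prime p hp hinj
  rcases hm with rfl | rfl
  · exact hsq
  · have hodd : Odd n := hn ▸ odd_prod_of_prime_ne_two p hp hp2
    exact (Nat.squarefree_mul (Nat.coprime_two_left.mpr hodd)).mpr ⟨Nat.prime_two.squarefree, hsq⟩

/-! ## §2 The pair form: `BSD(E^{(m)}, 2)` ⟺ `ord₂ #Ш_an(E^{(m)}) = 0` -/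

/-- **`BSD(E^{(m)}, 2)` IS `ord₂ #Ш_an(E^{(m)}) = 0` on Tian's family (Tian 2014 Thm 1.3 at `2`,
pair form).** Hypotheses VERBATIM as typed by p2-lit-1 (`Tian2014.thm13_rank_one_and_sha_odd`,
binders): `p₀, …, p_k` distinct odd primes (`p : Fin (k+1) → ℕ` injective, `pᵢ ≠ 2`), `pᵢ ≡ 1 (8)`
for `i ≠ 0`, `n = ∏ pᵢ`, `K` a quadratic field containing `√−2n` with (1.1) (`Condition11 n K`),
`m = n` or `2n`, `m ≡ 5, 6, 7 (mod 8)`. Print gives `rank E^{(m)}(ℚ) = 1 = r_an(E^{(m)})` and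
`Ш(E^{(m)})` finite of ODD order, i.e. `Ш(E^{(m)})(2) = 0`
(`Tian2014.card_primaryComponent_two_eq_one_of_thm13`). Hence, by the definition of Miller's
`BSD(E,2)` alone (no GZK, no modularity): `BSDp (congruentNumberCurve m) 2` ⟺ `#Ш_an(E^{(m)})` is a
rational number of `2`-adic valuation `0`. What a certificate for such a pair computes is thereby
NAMED: the exact `2`-adic valuation of `L′(E^{(m)},1)·#tor²/(Ω·∏c_ℓ·ĥ(generator))` — the
"Gross–Zagier heights at `2`" of mandate (i); no descent. Remark 1.4 of the source: the `2`-part of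
the formula is NOT claimed in print. A per-pair statement; it closes no class.
[cite: Tian2014, Thm. 1.3 and Rem. 1.4 (arXiv:1210.8231 p. 2, L5–L22)] [cite: Miller2011LMS, Def. 1.1] -/
theorem bsdp_two_iff_shaAn_twoAdicUnit_of_tian13 (h13 : thm13_rank_one_and_sha_odd)
    (k : ℕ) (p : Fin (k + 1) → ℕ) (hp : ∀ i, (p i).Prime) (hp2 : ∀ i, p i ≠ 2)
    (hinj : Function.Injective p) (h8 : ∀ i, i ≠ 0 → p i % 8 = 1) (n : ℕ) (hn : n = ∏ i, p i)
    (K : Type) [Field K] [NumberField K] (hK : IsQuadraticFieldOfSqrt K (-(2 * n : ℤ)))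
    (h11 : Condition11 n K) (m : ℕ) (hm : m = n ∨ m = 2 * n)
    (hm8 : m % 8 = 5 ∨ m % 8 = 6 ∨ m % 8 = 7) :
    (congruentNumberCurve m).analyticRank = 1 ∧
      (BSDp (congruentNumberCurve m) 2 ↔
        ∃ q : ℚ, shaAn (congruentNumberCurve m) = (q : ℂ) ∧ padicValRat 2 q = 0) := by
  obtain ⟨hrk, hr, hfin, hodd⟩ := h13 k p hp hp2 hinj h8 n hn K hK h11 m hm hm8
  haveI := hfin
  haveI : Fact (2 : ℕ).Prime := ⟨Nat.prime_two⟩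
  have hprim : padicValNat 2 (Nat.card (AddCommGroup.primaryComponent (congruentNumberCurve m).sha 2))
      = 0 := by
    rw [card_primaryComponent_two_eq_one_of_thm13 h13 k p hp hp2 hinj h8 n hn K hK h11 m hm hm8]
    simp
  refine ⟨hr, ⟨?_, ?_⟩⟩
  · rintro ⟨-, -, q, hq, hv⟩
    exact ⟨q, hq, by rw [hv, hprim, Nat.cast_zero]⟩
  · rintro ⟨q, hq, hv⟩
    exact ⟨by rw [hrk, hr], Finite.of_injective _ Subtype.val_injective, q, hq,
      by rw [hv, hprim, Nat.cast_zero]⟩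

/-- The same in the census currency `MissingPPartAt` (`#Ш_an = q`, `ord₂ q = ord₂ #Ш`): on Tian's
family `ord₂ #Ш(E^{(m)}) = 0`, so the missing `2`-part output is exactly `ord₂ #Ш_an = 0`.
[cite: Tian2014, Thm. 1.3 (arXiv:1210.8231 p. 2)] [cite: Miller2011LMS, Def. 1.1] -/
theorem missingPPartAt_two_iff_of_tian13 (h13 : thm13_rank_one_and_sha_odd)
    (k : ℕ) (p : Fin (k + 1) → ℕ) (hp : ∀ i, (p i).Prime) (hp2 : ∀ i, p i ≠ 2)
    (hinj : Function.Injective p) (h8 : ∀ i, i ≠ 0 → p i % 8 = 1) (n : ℕ) (hn : n = ∏ i, p i)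
    (K : Type) [Field K] [NumberField K] (hK : IsQuadraticFieldOfSqrt K (-(2 * n : ℤ)))
    (h11 : Condition11 n K) (m : ℕ) (hm : m = n ∨ m = 2 * n)
    (hm8 : m % 8 = 5 ∨ m % 8 = 6 ∨ m % 8 = 7) :
    MissingPPartAt (congruentNumberCurve m) 2 ↔
      ∃ q : ℚ, shaAn (congruentNumberCurve m) = (q : ℂ) ∧ padicValRat 2 q = 0 := by
  obtain ⟨-, -, hfin, hodd⟩ := h13 k p hp hp2 hinj h8 n hn K hK h11 m hm hm8
  haveI := hfin
  have h0 : padicValNat 2 (congruentNumberCurve m).shaOrder = 0 :=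
    padicValNat.eq_zero_of_not_dvd hodd.not_two_dvd_nat
  unfold MissingPPartAt
  rw [h0, Nat.cast_zero]

/-! ## §3 Grid placement: the open O12 corner, `2` ramified in `ℚ(i)`, analytic rank `1` -/

/-- **Where Tian's family sits**: `E^{(m)}` has CM (`j = 1728`) with `2` RAMIFIED in `K = ℚ(i)` and
analytic rank `1` (Thm 1.3), so its cell (on the globally minimal model `congruentNumberCurve m`,
`m` square-free) is `r1.<red>.<img>.ramified`, of status `openO12` — a sub-family of the OPEN CM
corner whose algebraic `2`-part is in print; nothing recoloured.
[cite: Tian2014, Thm. 1.3 (arXiv:1210.8231 p. 2)] -/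
theorem status_congruentNumberCurve_of_tian13 (h13 : thm13_rank_one_and_sha_odd)
    (k : ℕ) (p : Fin (k + 1) → ℕ) (hp : ∀ i, (p i).Prime) (hp2 : ∀ i, p i ≠ 2)
    (hinj : Function.Injective p) (h8 : ∀ i, i ≠ 0 → p i % 8 = 1) (n : ℕ) (hn : n = ∏ i, p i)
    (K : Type) [Field K] [NumberField K] (hK : IsQuadraticFieldOfSqrt K (-(2 * n : ℤ)))
    (h11 : Condition11 n K) (m : ℕ) (hm : m = n ∨ m = 2 * n)
    (hm8 : m % 8 = 5 ∨ m % 8 = 6 ∨ m % 8 = 7) :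
    haveI := isElliptic_congruentNumberCurve (squarefree_of_tian13_setting p hp hp2 hinj hn hm).ne_zero
    haveI := isGloballyMinimal_congruentNumberCurve (squarefree_of_tian13_setting p hp hp2 hinj hn hm)
    (congruentNumberCurve m).HasCM ∧ CMRamified (congruentNumberCurve m) 2 ∧
      (cellAtTwoOf (congruentNumberCurve m)).r1 = true ∧
      (cellAtTwoOf (congruentNumberCurve m)).cm = .ramified ∧
      (cellAtTwoOf (congruentNumberCurve m)).status = .openO12 := by
  have hsq := squarefree_of_tian13_setting p hp hp2 hinj hn hm
  haveI := isElliptic_congruentNumberCurve hsq.ne_zero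
  haveI := isGloballyMinimal_congruentNumberCurve hsq
  obtain ⟨-, hr, -, -⟩ := h13 k p hp hp2 hinj h8 n hn K hK h11 m hm hm8
  have hj : (congruentNumberCurve m).j = 1728 := congruentNumberCurve_j m
  have hcm : (congruentNumberCurve m).HasCM := hasCM_of_j_eq_1728 _ hj
  have hram : CMRamified (congruentNumberCurve m) 2 := by
    show (2 : ℤ) ∣ cmFieldDiscrOfJ (congruentNumberCurve m).j
    rw [hj, cmFieldDiscrOfJ]; norm_num
  have hr1 : (cellAtTwoOf (congruentNumberCurve m)).r1 = true := by
    show decide ((congruentNumberCurve m).analyticRank = 1) = true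
    rw [decide_eq_true hr]
  have hcmv : (cellAtTwoOf (congruentNumberCurve m)).cm = .ramified := by
    show cmAtTwoOf (congruentNumberCurve m) = .ramified
    unfold cmAtTwoOf
    rw [if_neg (not_not_intro hcm), if_neg (fun h : CMSplit (congruentNumberCurve m) 2 => h.1 hram),
      if_pos hram]
  exact ⟨hcm, hram, hr1, hcmv, status_eq_openO12_of_ramified _
    (consistent_cellAtTwoOf (congruentNumberCurve m) (by omega)) hcmv hr1⟩

end Summit.BirchSwinnertonDyer.Rank1Residual.P2

end
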